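import Literature.NumberTheory.LFunctions.WeilTwoPrimeDeflL2Base
import Literature.NumberTheory.LFunctions.WeilBlockRowsPZ
import HarnessLib

/-!
# Deflated two-prime certificate L2: the factored even inverse agrees with `D`, rows 120–127

`WeilCert.checkDnRow` (even block) for certificate L2, by `decide +kernel`. Pure proof file.
-/

noncomputable section

namespace Literature.NumberTheory.LFunctions

set_option maxHeartbeats 0 in
/-- Row 120 of `DnE/LsE` is row 120 of the even `D` (certificate L2). [folklore] -/
theorem checkDnRow0_120_weilCertDeflL2 : weilCertDeflL2Base.checkDnRow weilCertDeflL2DnE weilCertDeflL2LsE 0 120 = true := by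
  decide +kernel

set_option maxHeartbeats 0 in
/-- Row 121 of `DnE/LsE` is row 121 of the even `D` (certificate L2). [folklore] -/
theorem checkDnRow0_121_weilCertDeflL2 : weilCertDeflL2Base.checkDnRow weilCertDeflL2DnE weilCertDeflL2LsE 0 121 = true := by
  decide +kernel

set_option maxHeartbeats 0 in
/-- Row 122 of `DnE/LsE` is row 122 of the even `D` (certificate L2). [folklore] -/
theorem checkDnRow0_122_weilCertDeflL2 : weilCertDeflL2Base.checkDnRow weilCertDeflL2DnE weilCertDeflL2LsE 0 122 = true := by
  decide +kernel

set_option maxHeartbeats 0 in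
/-- Row 123 of `DnE/LsE` is row 123 of the even `D` (certificate L2). [folklore] -/
theorem checkDnRow0_123_weilCertDeflL2 : weilCertDeflL2Base.checkDnRow weilCertDeflL2DnE weilCertDeflL2LsE 0 123 = true := by
  decide +kernel

set_option maxHeartbeats 0 in
/-- Row 124 of `DnE/LsE` is row 124 of the even `D` (certificate L2). [folklore] -/
theorem checkDnRow0_124_weilCertDeflL2 : weilCertDeflL2Base.checkDnRow weilCertDeflL2DnE weilCertDeflL2LsE 0 124 = true := by
  decide +kernel

set_option maxHeartbeats 0 in
/-- Row 125 of `DnE/LsE` is row 125 of the even `D` (certificate L2). [folklore] -/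
theorem checkDnRow0_125_weilCertDeflL2 : weilCertDeflL2Base.checkDnRow weilCertDeflL2DnE weilCertDeflL2LsE 0 125 = true := by
  decide +kernel

set_option maxHeartbeats 0 in
/-- Row 126 of `DnE/LsE` is row 126 of the even `D` (certificate L2). [folklore] -/
theorem checkDnRow0_126_weilCertDeflL2 : weilCertDeflL2Base.checkDnRow weilCertDeflL2DnE weilCertDeflL2LsE 0 126 = true := by
  decide +kernel

set_option maxHeartbeats 0 in
/-- Row 127 of `DnE/LsE` is row 127 of the even `D` (certificate L2). [folklore] -/
theorem checkDnRow0_127_weilCertDeflL2 : weilCertDeflL2Base.checkDnRow weilCertDeflL2DnE weilCertDeflL2LsE 0 127 = true := by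
  decide +kernel


end Literature.NumberTheory.LFunctions
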